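import Summits.QuantumFields.YangMills.Theorems.BalabanUVNodesN24Stub1VWShareK1AxV114AERow
import Summits.QuantumFields.YangMills.Theorems.BalabanUVNodesN24Stub23VWShareK1AxV11

/-!
# BalabanUVNodes ∕ K1ᴬ LINE 2′ v11.4 — N24's SHARES OF `stub_runRows13PWSVW` AND `stub_cont13VW` RE-KEYED TO THE (R-a″) RUN-KEYED MEMORY GUARD (★★★ director-ym №682 (2)(e′) ∕ №685; ✦ plan g104 v11.4
# registered 33e8cfceee350f1c): the (R1) file ✓p813862 `…N24Stub23VWShareK1AxV11` with the rung-1ⱽᵂ witness ∕ body read at the v11.4 text (`K1AxV114Defs.NodesAtSomeRecord13PWSVW`: the [IV]-pin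
# conjunct MEMORY-GUARDED) and N12's bill `h12` in dag-n12-d's MEMORY-GUARDED currency; everything else byte-kept

TRACK A (YM-PLAN §2d), node N24 (binder B2, COMPOSITE), seat `pub-ymgap-dag-n24-c` g27 (the -a hand on LINE 2′; v11.4 edition — the V113 sibling of this file is HISTORY of the 82-minute v11.3 record), `--kind proof --supports stmt-QuantumFields-27239 --as helper` (count-neutral; conditional
producers of the stubs' texts — no stub is closed until every bill is paid).  PARENT OF RECORD: ✓p813862 (g24).  DECLARED EDITS (generator `gen_e.py R1` over the tree bytes, every edit counted):
(M3) `h12`'s family form MEMORY-GUARDED (`… → Step.InInterval γ₁₂ … → B15Claim189PinsOfHistory.N0OfRecord₁₃Ax (Θ F i).toStage13Params P P.K ≤ P.K → B15Leaf …`); (M4) the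
rung-1ⱽᵂ body `hbody` of §1's packers carries the guarded pin conjunct; the rebuilt witness comes from the v11.4 parent `…N24Stub1VWShareK1AxV114AERow.N24_rung1VW_bodyAt_of_bills_at_aeRow`; `stub_runRows13PWSVW`'s
hypothesis is the v11.3 text.  Theorem names = the parent's, in the sibling namespace `…N24Stub23VWShareK1AxV114` (unchanged theorems, if any, are the parent's by `open`).

WHAT IS HERE (theorems only; 0 `def`, 0 `sorry`, standard axioms):
* §1 `N24_runRowsAtSomeRecord13PWSVW_of_bodyAt_of_rows` ∕ `N24_runRowsContAtSomeRecord13PWSVW_of_bodyAt_of_rows_of_cont` — rungs 2ⱽᵂ ∕ 2ⱽᵂ‴ BY NAME at a KEPT rung-1ⱽᵂ (v11.4) witness, the run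
  rows (i)–(iv) (+ (C) at the same level) attached with the ceiling match `B + r ≤ w.βup` (the rung-2 texts are UNCHANGED at v11.4: they never read the pin).
* §2 ★★ `stub2TextVW_of_bills_atWitnessFamily` ∕ `stub3TextVW_of_bills_atWitnessFamily` — `stub_runRows13PWSVW` (v11.4 hypothesis) ∕ `stub_cont13VW`'s SIGNATURES from the rung-1 per-node bills +
  NODE O's RUN-ROWS BILL `hrows` (+ the (C) BILL `hC`) read AT A WITNESS FAMILY `Θ F i`; `stub3TextVW_of_contBill` as in the parent.

HONEST COST (★★★ №663 (1), verbatim): «N12 ([IV] basic step) is pinned at every windowed run WHOSE MEMORY FITS; at shorter runs the `rBasicStep` leaf of `Nodes` is unpinned because print applies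
no 𝐑 there» — a GAP-STATED corner, named and sourced.
HONEST SCOPE ∕ A6.  Implications only; every bill is a DISPLAYED hypothesis; nothing of Bałaban asserted; no stub closed; K1ᴬ OPEN (0∕6 v11.4); N24 COMPOSITE — no discharge, no count claim
(discharged 8∕27 · K 1∕4 unmoved).  One finite 𝕋⁴ programme at fixed ε — NOT continuum ∕ ℝ⁴ ∕ OS; NOT the Yang–Mills mass gap (Clay).  No `def`, no `instance`, no `sorry`.
References (bookkeeping only): [Balaban1987RG1] Thm 3 p.264, (1.20)–(1.22) p.264, (5.10) p.293, §1 pp.263–264; [Balaban1988RG2Cluster] (2.41) p.21; [Balaban1989LargeFieldII] Thm 1 p.355, (0.1) pp.355–356;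
[Balaban1989LargeFieldI] (0.2)–(0.6) p.176, p.177 (ii), p.179, Prop. 1 p.194, p.200 (statement shapes; bookkeeping).
-/

noncomputable section

open scoped BigOperators
open MeasureTheory

namespace Summit.QuantumFields.YangMills.BalabanUVNodes.N24Stub23VWShareK1AxV114

open Literature.MathematicalPhysics.QuantumFieldTheory.Balaban1983to89
open Literature.MathematicalPhysics.QuantumFieldTheory.Balaban1983to89.Node00
open DagBinding T4Continuum FlowStepRuns
open FlowStep (RGEqH prefixOf)
open Summit.QuantumFields.YangMills.Theorems.BalabanUVNodesK2NamedJetsRunRemAt (RunConstRemainder SurvCont)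
open Summit.QuantumFields.YangMills.Theorems.K1AxV11Defs (Inhabited13 RecordSV RunRowsAtSomeRecord13PWSVW RunRowsContAtSomeRecord13PWSVW)
open Summit.QuantumFields.YangMills.Theorems.K1AxV114Defs (NodesAtSomeRecord13PWSVW)
open Summit.QuantumFields.YangMills.BalabanUVNodes.N24Stub23VWShareK1AxV11 (stub3TextVW_of_contBill)
open Summit.QuantumFields.YangMills.BalabanUVNodes.N24Stub1VWShareK1AxV114AERow (N24_rung1VW_bodyAt_of_bills_at_aeRow stub1TextVW_of_bills_atWitnessFamily_aeRow)

variable {F : T4Family}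

/-! ## §1. Rungs 2ⱽᵂ ∕ 2ⱽᵂ‴ BY NAME at a KEPT rung-1ⱽᵂ witness -/

/-- **RUNG 2ⱽᵂ `K1AxV11Defs.RunRowsAtSomeRecord13PWSVW F` BY NAME AT A KEPT RUNG-1ⱽᵂ WITNESS**: rung 1ⱽᵂ's body at `(θ, h, v, w)` (e.g. the parent's `N24_rung1VW_bodyAt_pointed` ∕
`N24_rung1VW_bodyAt_of_bills_at_aeRow`) and the run rows (i)–(iv) of `β_θ := betaOfRecord₁₃Ax θ` on a level `γ₀ > 0` with the ceiling match `B + r ≤ w.βup` ⟹ rung 2ⱽᵂ (which drops N08's sentence and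
the [IV] pin; the nodes stay window-guarded).  COMPOSITE; nothing is discharged. [cite: Balaban1987RG1, Thm 3 p.264, (1.22) p.264, (5.10) p.293; Balaban1988RG2Cluster, (2.41) p.21 (statement shapes; bookkeeping)] -/
theorem N24_runRowsAtSomeRecord13PWSVW_of_bodyAt_of_rows (θ : Stage13HParams F 2) (h : θ.Provisos₁₃SepCoPHAx F 2) (v : Revision₁₃Ax F 2 θ h) (w : WorldP)
    (hbody : (θ.ZhUnity F 2 ∧ θ.SlotsNondegenerate₁₃Ax F 2) ∧ θ.Admissible F 2 ∧ RecordSV F θ h v w ∧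
      (∀ P : B12.RunParams, (leavesP w P).smallCouplings → Nodes (leavesP w P)) ∧ PrintedUV3V 2 θ.L ∧
      ∃ lam : ResidW F 2, (∀ P : B12.RunParams, 1 ≤ P.K → lam.kSel P < P.K) ∧
        ∀ P : B12.RunParams, lam.kSel P < P.K → (leavesP w P).smallCouplings →
          B15Claim189PinsOfHistory.N0OfRecord₁₃Ax θ.toStage13Params P P.K ≤ P.K → ((leavesP w P).rBasicStep ↔ B15Leaf (WOfRecord₁₃Ax F 2 θ.toStage13Params lam P)))
    {b : ℕ → ℝ} {r γ₀ B M : ℝ} (hγ₀ : 0 < γ₀) (hrem : RunConstRemainder (betaOfRecord₁₃Ax F 2 θ.toStage13Params) b r γ₀) (hB : ∀ k, b k ≤ B) (hmatch : B + r ≤ w.βup)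
    (hps : ∀ (n : ℕ) (gs : ℕ → ℝ), RGEqH n (betaOfRecord₁₃Ax F 2 θ.toStage13Params) gs → Step.InInterval γ₀ n gs →
      ∀ k, k ≤ n → -M ≤ ∑ j ∈ Finset.Ico k n, betaOfRecord₁₃Ax F 2 θ.toStage13Params j (prefixOf gs j)) :
    RunRowsAtSomeRecord13PWSVW F :=
  ⟨θ, h, v, w, hbody.1, hbody.2.1, hbody.2.2.1, hbody.2.2.2.1, b, r, γ₀, B, M, hγ₀, hrem, hB, hmatch, hps⟩

/-- **RUNG 2ⱽᵂ‴ `K1AxV11Defs.RunRowsContAtSomeRecord13PWSVW F` BY NAME AT A KEPT RUNG-1ⱽᵂ WITNESS**: as above plus (C) `SurvCont β_θ γ₀` at the SAME level.  COMPOSITE; nothing is discharged.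
[cite: Balaban1987RG1, Thm 3 p.264, (1.22) p.264, §1 pp.263–264 (statement shapes; bookkeeping)] -/
theorem N24_runRowsContAtSomeRecord13PWSVW_of_bodyAt_of_rows_of_cont (θ : Stage13HParams F 2) (h : θ.Provisos₁₃SepCoPHAx F 2) (v : Revision₁₃Ax F 2 θ h) (w : WorldP)
    (hbody : (θ.ZhUnity F 2 ∧ θ.SlotsNondegenerate₁₃Ax F 2) ∧ θ.Admissible F 2 ∧ RecordSV F θ h v w ∧
      (∀ P : B12.RunParams, (leavesP w P).smallCouplings → Nodes (leavesP w P)) ∧ PrintedUV3V 2 θ.L ∧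
      ∃ lam : ResidW F 2, (∀ P : B12.RunParams, 1 ≤ P.K → lam.kSel P < P.K) ∧
        ∀ P : B12.RunParams, lam.kSel P < P.K → (leavesP w P).smallCouplings →
          B15Claim189PinsOfHistory.N0OfRecord₁₃Ax θ.toStage13Params P P.K ≤ P.K → ((leavesP w P).rBasicStep ↔ B15Leaf (WOfRecord₁₃Ax F 2 θ.toStage13Params lam P)))
    {b : ℕ → ℝ} {r γ₀ B M : ℝ} (hγ₀ : 0 < γ₀) (hrem : RunConstRemainder (betaOfRecord₁₃Ax F 2 θ.toStage13Params) b r γ₀) (hB : ∀ k, b k ≤ B) (hmatch : B + r ≤ w.βup)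
    (hps : ∀ (n : ℕ) (gs : ℕ → ℝ), RGEqH n (betaOfRecord₁₃Ax F 2 θ.toStage13Params) gs → Step.InInterval γ₀ n gs →
      ∀ k, k ≤ n → -M ≤ ∑ j ∈ Finset.Ico k n, betaOfRecord₁₃Ax F 2 θ.toStage13Params j (prefixOf gs j))
    (hsc : SurvCont (betaOfRecord₁₃Ax F 2 θ.toStage13Params) γ₀) :
    RunRowsContAtSomeRecord13PWSVW F :=
  ⟨θ, h, v, w, hbody.1, hbody.2.1, hbody.2.2.1, hbody.2.2.2.1, b, r, γ₀, B, M, hγ₀, hrem, hB, hmatch, hps, hsc⟩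

/-! ## §2. ★★ The texts of `stub_runRows13PWSVW` and `stub_cont13VW` from the bills -/

/-- **★★ `stub_runRows13PWSVW`'s TEXT FROM THE RUNG-1 PER-NODE BILLS AND NODE O's RUN-ROWS BILL AT A WITNESS FAMILY.**  The stub's hypothesis `NodesAtSomeRecord13PWSVW F` yields rung 0 at `F`,
hence a member `i` of the family (`hK0`); NODE O's bill `hrows` at `Θ F i` gives the rows (i) `RunConstRemainder (betaOfRecord₁₃Ax θ) b r γ₀`, (ii) `b ≤ B`, (iv) the partial-sum floor `−M` on
`γ₀ > 0`; the rung-1 bills at `Θ F i` REBUILD the revision and the S-bound world with the ceiling letter `βup := B + r` (parent `N24_rung1VW_bodyAt_of_bills_at_aeRow`), so (iii) `B + r ≤ w.βup` holds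
by construction — the witness is RE-CHOSEN at the family's θ («a prover may keep stub 1's witness or re-choose it»).  CONDITIONAL; closes nothing; nothing of Bałaban asserted.
[cite: Balaban1987RG1, Thm 3 p.264, (1.20)–(1.22) p.264, (5.10) p.293; Balaban1988RG2Cluster, (2.41) p.21; Balaban1989LargeFieldII, Thm 1 p.355, (0.1) pp.355–356 (statement shapes; bookkeeping)] -/
theorem stub2TextVW_of_bills_atWitnessFamily (ι : T4Family → Type) (Θ : ∀ F : T4Family, ι F → Stage13HParams F 2) (hK0 : ∀ F : T4Family, Inhabited13 F → Nonempty (ι F))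
    (hP : ∀ (F : T4Family) (i : ι F), (Θ F i).Provisos₁₃SepCoPHAx F 2) (hU : ∀ (F : T4Family) (i : ι F), (Θ F i).ZhUnity F 2 ∧ (Θ F i).SlotsNondegenerate₁₃Ax F 2)
    (hθ : ∀ (F : T4Family) (i : ι F), (Θ F i).Admissible F 2)
    (h05 : ∀ (F : T4Family) (i : ι F), ∃ lam8 : ResidB8 (Θ F i).toStage3Params, B8LeafOfRecordSubBH (Θ F i).toStage3Params lam8)
    (h06 : ∀ (F : T4Family) (_ : ι F), ∃ Y₀ : PrintedCarriers9X, B9LeafX Y₀)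
    (h07 : ∀ (F : T4Family) (_ : ι F), ∃ ζ : ResidZ F 2, B11Leaf (Z11OfRecord F 2 ζ))
    (h08 : ∀ (F : T4Family) (i : ι F), PrintedUV3V 2 (Θ F i).L)
    (h09 : ∀ (F : T4Family) (i : ι F), ∃ lam12 : ResidB12 F 2 (Θ F i).τ9.M,
      ∀ P : B12.RunParams, B12Sec2to5.Lemma4Printed (F12OfRecord₁₂ F 2 (Θ F i).toStage12Params lam12 P) (lam12 P).consts)
    (h09T : ∀ (F : T4Family) (i : ι F), ∃ γ₉ : ℝ, 0 < γ₉ ∧ ∀ w : WorldP, w.C = (datumOfRecord₁₃SepCoPHAx F 2 (Θ F i) (hP F i)).C → w.γ ≤ γ₉ →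
      ∀ P : B12.RunParams, (leavesP w P).smallCouplings → (leavesP w P).smallFieldInductive)
    (h10 : ∀ (F : T4Family) (i : ι F), ∃ lam13 : B12.RunParams → ResidB13 (Θ F i).toStage3Params, ∀ P : B12.RunParams, B13LeafOfRecord (Θ F i).toStage3Params (lam13 P))
    (h11 : ∀ (F : T4Family) (i : ι F), ∀ βup β₀ : ℝ, ∃ γ₁₁ : ℝ, 0 < γ₁₁ ∧ ∀ w : WorldP, w.C = (datumOfRecord₁₃SepCoPHAx F 2 (Θ F i) (hP F i)).C → w.βup = βup → w.β₀ = β₀ → w.γ ≤ γ₁₁ →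
      ∀ P : B12.RunParams, (leavesP w P).b7 → (leavesP w P).b8 → (leavesP w P).b9 → (leavesP w P).b10 → (leavesP w P).b11 →
        (leavesP w P).smallCouplings → (leavesP w P).smallFieldInductive → (leavesP w P).flowControl →
          ∀ k, k < P.K → SLaw₁₃CoPHChi F 2 (Θ F i) (chiβOfRecord₁₃Ax F 2 (Θ F i).toStage13Params) P k → TLaw₁₃CoPHChi F 2 (Θ F i) (chiβOfRecord₁₃Ax F 2 (Θ F i).toStage13Params) P k)
    (hR : ∀ (F : T4Family) (i : ι F) (P : B12.RunParams) (k : ℕ), k < P.K →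
      TLaw₁₃CoPHChi F 2 (Θ F i) (chiβOfRecord₁₃Ax F 2 (Θ F i).toStage13Params) P k → SLaw₁₃CoPHChi F 2 (Θ F i) (chiβOfRecord₁₃Ax F 2 (Θ F i).toStage13Params) P (k + 1))
    (h12 : ∀ (F : T4Family) (i : ι F), ∃ (lamW : ResidW F 2) (γ₁₂ : ℝ), 0 < γ₁₂ ∧ (∀ P : B12.RunParams, 1 ≤ P.K → lamW.kSel P < P.K) ∧
      ∀ P : B12.RunParams, lamW.kSel P < P.K → Step.InInterval γ₁₂ P.K (gOfRecord₁₃Ax F 2 (Θ F i).toStage13Params P) →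
        B15Claim189PinsOfHistory.N0OfRecord₁₃Ax (Θ F i).toStage13Params P P.K ≤ P.K → B15Leaf (WOfRecord₁₃Ax F 2 (Θ F i).toStage13Params lamW P))
    (h13 : ∀ (F : T4Family) (i : ι F), ∃ γ₁₃ : ℝ, 0 < γ₁₃ ∧ ∃ em ep : ℝ → ℝ,
        (∀ P : B12.RunParams, ((datumOfRecord₁₃SepCoPHAx F 2 (Θ F i) (hP F i)).C P).flow.InInterval γ₁₃ P.K → SLaw₁₃CoPHChi F 2 (Θ F i) (chiβOfRecord₁₃Ax F 2 (Θ F i).toStage13Params) P 0 →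
      ∀ U : GaugeField (F.P P.K) 0 (SU 2),
        chiβOfRecord₁₃Ax F 2 (Θ F i).toStage13Params P.K (gOfRecord₁₃Ax F 2 (Θ F i).toStage13Params P) 0 U *
              Real.exp (-(1 / (gOfRecord₁₃Ax F 2 (Θ F i).toStage13Params P 0) ^ 2 * wilsonBGOfRecord F 2 (Θ F i).εbg P 0 U)
                - em (gOfRecord₁₃Ax F 2 (Θ F i).toStage13Params P 0) * (Fintype.card (Site (F.P P.K) 0) : ℝ)) ≤ densOfRecord₁₃Chi F 2 (Θ F i).toStage13Params (chiβOfRecord₁₃Ax F 2 (Θ F i).toStage13Params) P 0 U ∧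
          densOfRecord₁₃Chi F 2 (Θ F i).toStage13Params (chiβOfRecord₁₃Ax F 2 (Θ F i).toStage13Params) P 0 U ≤ Real.exp (ep (gOfRecord₁₃Ax F 2 (Θ F i).toStage13Params P 0) * (Fintype.card (Site (F.P P.K) 0) : ℝ))) ∧
        (∀ P : B12.RunParams, ((datumOfRecord₁₃SepCoPHAx F 2 (Θ F i) (hP F i)).C P).flow.InInterval γ₁₃ P.K → ∀ k, k + 1 ≤ P.K → SLaw₁₃CoPHChi F 2 (Θ F i) (chiβOfRecord₁₃Ax F 2 (Θ F i).toStage13Params) P (k + 1) →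
      ∀ᵐ U ∂(fieldMeasure (F.P P.K) (k + 1) (SU 2)),
        chiβOfRecord₁₃Ax F 2 (Θ F i).toStage13Params P.K (gOfRecord₁₃Ax F 2 (Θ F i).toStage13Params P) (k + 1) U *
              Real.exp (-(1 / (gOfRecord₁₃Ax F 2 (Θ F i).toStage13Params P (k + 1)) ^ 2 * wilsonBGOfRecord F 2 (Θ F i).εbg P (k + 1) U)
                - em (gOfRecord₁₃Ax F 2 (Θ F i).toStage13Params P (k + 1)) * (Fintype.card (Site (F.P P.K) (k + 1)) : ℝ)) ≤ densOfRecord₁₃Chi F 2 (Θ F i).toStage13Params (chiβOfRecord₁₃Ax F 2 (Θ F i).toStage13Params) P (k + 1) U ∧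
          densOfRecord₁₃Chi F 2 (Θ F i).toStage13Params (chiβOfRecord₁₃Ax F 2 (Θ F i).toStage13Params) P (k + 1) U ≤ Real.exp (ep (gOfRecord₁₃Ax F 2 (Θ F i).toStage13Params P (k + 1)) * (Fintype.card (Site (F.P P.K) (k + 1)) : ℝ))))
    (hrows : ∀ (F : T4Family) (i : ι F), ∃ (b : ℕ → ℝ) (r γ₀ B M : ℝ), 0 < γ₀ ∧ RunConstRemainder (betaOfRecord₁₃Ax F 2 (Θ F i).toStage13Params) b r γ₀ ∧ (∀ k, b k ≤ B) ∧
      ∀ (n : ℕ) (gs : ℕ → ℝ), RGEqH n (betaOfRecord₁₃Ax F 2 (Θ F i).toStage13Params) gs → Step.InInterval γ₀ n gs →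
        ∀ k, k ≤ n → -M ≤ ∑ j ∈ Finset.Ico k n, betaOfRecord₁₃Ax F 2 (Θ F i).toStage13Params j (prefixOf gs j))
    :
    ∀ F : T4Family, NodesAtSomeRecord13PWSVW F → RunRowsAtSomeRecord13PWSVW F := by
  intro F hN
  obtain ⟨θ₀, h₀, -, -, hU₀, hθ₀, -⟩ := hN
  obtain ⟨i⟩ := hK0 F ⟨θ₀, h₀, hU₀, hθ₀⟩
  obtain ⟨b, r, γ₀, B, M, hγ₀, hrem, hB, hps⟩ := hrows F i
  obtain ⟨v, w, hβup, -, hbody⟩ := N24_rung1VW_bodyAt_of_bills_at_aeRow F (Θ F i) (hP F i) (hU F i) (hθ F i) (h05 F i) (h06 F i) (h07 F i) (h08 F i) (h09 F i)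
    (h09T F i) (h10 F i) (h11 F i) (hR F i) (h12 F i) (h13 F i) (B + r)
  exact N24_runRowsAtSomeRecord13PWSVW_of_bodyAt_of_rows (Θ F i) (hP F i) v w hbody hγ₀ hrem hB (le_of_eq hβup.symm) hps

/-- **★★ `stub_cont13VW`'s TEXT FROM THE BILLS AT A WITNESS FAMILY** (rows AND (C) rebuilt at the family's θ; (C) attached at the level `min γ₀ γc`, the rows cut there by `RunConstRemainder.mono`
and the antitone floor).  CONDITIONAL; closes nothing; (C) is [I] §1 pp.263–264's continuity of the effective-action coefficients in the couplings, asserted in print WITHOUT proof.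
[cite: Balaban1987RG1, §1 pp.263–264, Thm 3 p.264, (1.22) p.264, (5.10) p.293; Balaban1989LargeFieldII, Thm 1 p.355 (statement shapes; bookkeeping)] -/
theorem stub3TextVW_of_bills_atWitnessFamily (ι : T4Family → Type) (Θ : ∀ F : T4Family, ι F → Stage13HParams F 2) (hK0 : ∀ F : T4Family, Inhabited13 F → Nonempty (ι F))
    (hP : ∀ (F : T4Family) (i : ι F), (Θ F i).Provisos₁₃SepCoPHAx F 2) (hU : ∀ (F : T4Family) (i : ι F), (Θ F i).ZhUnity F 2 ∧ (Θ F i).SlotsNondegenerate₁₃Ax F 2)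
    (hθ : ∀ (F : T4Family) (i : ι F), (Θ F i).Admissible F 2)
    (h05 : ∀ (F : T4Family) (i : ι F), ∃ lam8 : ResidB8 (Θ F i).toStage3Params, B8LeafOfRecordSubBH (Θ F i).toStage3Params lam8)
    (h06 : ∀ (F : T4Family) (_ : ι F), ∃ Y₀ : PrintedCarriers9X, B9LeafX Y₀)
    (h07 : ∀ (F : T4Family) (_ : ι F), ∃ ζ : ResidZ F 2, B11Leaf (Z11OfRecord F 2 ζ))
    (h08 : ∀ (F : T4Family) (i : ι F), PrintedUV3V 2 (Θ F i).L)
    (h09 : ∀ (F : T4Family) (i : ι F), ∃ lam12 : ResidB12 F 2 (Θ F i).τ9.M,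
      ∀ P : B12.RunParams, B12Sec2to5.Lemma4Printed (F12OfRecord₁₂ F 2 (Θ F i).toStage12Params lam12 P) (lam12 P).consts)
    (h09T : ∀ (F : T4Family) (i : ι F), ∃ γ₉ : ℝ, 0 < γ₉ ∧ ∀ w : WorldP, w.C = (datumOfRecord₁₃SepCoPHAx F 2 (Θ F i) (hP F i)).C → w.γ ≤ γ₉ →
      ∀ P : B12.RunParams, (leavesP w P).smallCouplings → (leavesP w P).smallFieldInductive)
    (h10 : ∀ (F : T4Family) (i : ι F), ∃ lam13 : B12.RunParams → ResidB13 (Θ F i).toStage3Params, ∀ P : B12.RunParams, B13LeafOfRecord (Θ F i).toStage3Params (lam13 P))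
    (h11 : ∀ (F : T4Family) (i : ι F), ∀ βup β₀ : ℝ, ∃ γ₁₁ : ℝ, 0 < γ₁₁ ∧ ∀ w : WorldP, w.C = (datumOfRecord₁₃SepCoPHAx F 2 (Θ F i) (hP F i)).C → w.βup = βup → w.β₀ = β₀ → w.γ ≤ γ₁₁ →
      ∀ P : B12.RunParams, (leavesP w P).b7 → (leavesP w P).b8 → (leavesP w P).b9 → (leavesP w P).b10 → (leavesP w P).b11 →
        (leavesP w P).smallCouplings → (leavesP w P).smallFieldInductive → (leavesP w P).flowControl →
          ∀ k, k < P.K → SLaw₁₃CoPHChi F 2 (Θ F i) (chiβOfRecord₁₃Ax F 2 (Θ F i).toStage13Params) P k → TLaw₁₃CoPHChi F 2 (Θ F i) (chiβOfRecord₁₃Ax F 2 (Θ F i).toStage13Params) P k)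
    (hR : ∀ (F : T4Family) (i : ι F) (P : B12.RunParams) (k : ℕ), k < P.K →
      TLaw₁₃CoPHChi F 2 (Θ F i) (chiβOfRecord₁₃Ax F 2 (Θ F i).toStage13Params) P k → SLaw₁₃CoPHChi F 2 (Θ F i) (chiβOfRecord₁₃Ax F 2 (Θ F i).toStage13Params) P (k + 1))
    (h12 : ∀ (F : T4Family) (i : ι F), ∃ (lamW : ResidW F 2) (γ₁₂ : ℝ), 0 < γ₁₂ ∧ (∀ P : B12.RunParams, 1 ≤ P.K → lamW.kSel P < P.K) ∧
      ∀ P : B12.RunParams, lamW.kSel P < P.K → Step.InInterval γ₁₂ P.K (gOfRecord₁₃Ax F 2 (Θ F i).toStage13Params P) →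
        B15Claim189PinsOfHistory.N0OfRecord₁₃Ax (Θ F i).toStage13Params P P.K ≤ P.K → B15Leaf (WOfRecord₁₃Ax F 2 (Θ F i).toStage13Params lamW P))
    (h13 : ∀ (F : T4Family) (i : ι F), ∃ γ₁₃ : ℝ, 0 < γ₁₃ ∧ ∃ em ep : ℝ → ℝ,
        (∀ P : B12.RunParams, ((datumOfRecord₁₃SepCoPHAx F 2 (Θ F i) (hP F i)).C P).flow.InInterval γ₁₃ P.K → SLaw₁₃CoPHChi F 2 (Θ F i) (chiβOfRecord₁₃Ax F 2 (Θ F i).toStage13Params) P 0 →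
      ∀ U : GaugeField (F.P P.K) 0 (SU 2),
        chiβOfRecord₁₃Ax F 2 (Θ F i).toStage13Params P.K (gOfRecord₁₃Ax F 2 (Θ F i).toStage13Params P) 0 U *
              Real.exp (-(1 / (gOfRecord₁₃Ax F 2 (Θ F i).toStage13Params P 0) ^ 2 * wilsonBGOfRecord F 2 (Θ F i).εbg P 0 U)
                - em (gOfRecord₁₃Ax F 2 (Θ F i).toStage13Params P 0) * (Fintype.card (Site (F.P P.K) 0) : ℝ)) ≤ densOfRecord₁₃Chi F 2 (Θ F i).toStage13Params (chiβOfRecord₁₃Ax F 2 (Θ F i).toStage13Params) P 0 U ∧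
          densOfRecord₁₃Chi F 2 (Θ F i).toStage13Params (chiβOfRecord₁₃Ax F 2 (Θ F i).toStage13Params) P 0 U ≤ Real.exp (ep (gOfRecord₁₃Ax F 2 (Θ F i).toStage13Params P 0) * (Fintype.card (Site (F.P P.K) 0) : ℝ))) ∧
        (∀ P : B12.RunParams, ((datumOfRecord₁₃SepCoPHAx F 2 (Θ F i) (hP F i)).C P).flow.InInterval γ₁₃ P.K → ∀ k, k + 1 ≤ P.K → SLaw₁₃CoPHChi F 2 (Θ F i) (chiβOfRecord₁₃Ax F 2 (Θ F i).toStage13Params) P (k + 1) →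
      ∀ᵐ U ∂(fieldMeasure (F.P P.K) (k + 1) (SU 2)),
        chiβOfRecord₁₃Ax F 2 (Θ F i).toStage13Params P.K (gOfRecord₁₃Ax F 2 (Θ F i).toStage13Params P) (k + 1) U *
              Real.exp (-(1 / (gOfRecord₁₃Ax F 2 (Θ F i).toStage13Params P (k + 1)) ^ 2 * wilsonBGOfRecord F 2 (Θ F i).εbg P (k + 1) U)
                - em (gOfRecord₁₃Ax F 2 (Θ F i).toStage13Params P (k + 1)) * (Fintype.card (Site (F.P P.K) (k + 1)) : ℝ)) ≤ densOfRecord₁₃Chi F 2 (Θ F i).toStage13Params (chiβOfRecord₁₃Ax F 2 (Θ F i).toStage13Params) P (k + 1) U ∧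
          densOfRecord₁₃Chi F 2 (Θ F i).toStage13Params (chiβOfRecord₁₃Ax F 2 (Θ F i).toStage13Params) P (k + 1) U ≤ Real.exp (ep (gOfRecord₁₃Ax F 2 (Θ F i).toStage13Params P (k + 1)) * (Fintype.card (Site (F.P P.K) (k + 1)) : ℝ))))
    (hrows : ∀ (F : T4Family) (i : ι F), ∃ (b : ℕ → ℝ) (r γ₀ B M : ℝ), 0 < γ₀ ∧ RunConstRemainder (betaOfRecord₁₃Ax F 2 (Θ F i).toStage13Params) b r γ₀ ∧ (∀ k, b k ≤ B) ∧
      ∀ (n : ℕ) (gs : ℕ → ℝ), RGEqH n (betaOfRecord₁₃Ax F 2 (Θ F i).toStage13Params) gs → Step.InInterval γ₀ n gs →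
        ∀ k, k ≤ n → -M ≤ ∑ j ∈ Finset.Ico k n, betaOfRecord₁₃Ax F 2 (Θ F i).toStage13Params j (prefixOf gs j))
    (hC : ∀ (F : T4Family) (i : ι F), ∃ γc : ℝ, 0 < γc ∧ ∀ γ₀ : ℝ, 0 < γ₀ → γ₀ ≤ γc → SurvCont (betaOfRecord₁₃Ax F 2 (Θ F i).toStage13Params) γ₀)
    :
    ∀ F : T4Family, RunRowsAtSomeRecord13PWSVW F → RunRowsContAtSomeRecord13PWSVW F := by
  intro F hN
  obtain ⟨θ₀, h₀, -, -, hU₀, hθ₀, -⟩ := hN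
  obtain ⟨i⟩ := hK0 F ⟨θ₀, h₀, hU₀, hθ₀⟩
  obtain ⟨b, r, γ₀, B, M, hγ₀, hrem, hB, hps⟩ := hrows F i
  obtain ⟨γc, hγc, hsc⟩ := hC F i
  obtain ⟨v, w, hβup, -, hbody⟩ := N24_rung1VW_bodyAt_of_bills_at_aeRow F (Θ F i) (hP F i) (hU F i) (hθ F i) (h05 F i) (h06 F i) (h07 F i) (h08 F i) (h09 F i)
    (h09T F i) (h10 F i) (h11 F i) (hR F i) (h12 F i) (h13 F i) (B + r)
  have hγ₁ : 0 < min γ₀ γc := lt_min hγ₀ hγc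
  exact N24_runRowsContAtSomeRecord13PWSVW_of_bodyAt_of_rows_of_cont (Θ F i) (hP F i) v w hbody hγ₁ (hrem.mono (min_le_left _ _)) hB (le_of_eq hβup.symm)
    (fun n gs hrg hI k hk => hps n gs hrg (fun j hj => ⟨(hI j hj).1, (hI j hj).2.trans (min_le_left _ _)⟩) k hk) (hsc _ hγ₁ (min_le_right _ _))

end Summit.QuantumFields.YangMills.BalabanUVNodes.N24Stub23VWShareK1AxV114

end
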